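import Mathlib
import Literature.Analysis.FluidPDE.VectorCalculus
import Literature.Analysis.FluidPDE.ClassicalSolution
import Summits.NavierStokesRegularity.NavierStokesRegularity.Theses.ThreadingFlux
import Summits.NavierStokesRegularity.NavierStokesRegularity.Theorems.ThreadingFluxCentreJetDefs
import HarnessLib

/-!
# CentreVirial — the STEADY DECAYING STRATUM through KPR-type test fields ABOUT THE CENTRE
# (crux idea `centre-virial`, ns-idea-15 g9, lens «negation»; crux `ThreadingFlux.PoloidalLiouville`, stmt-1222, wall W1 =
# `stub_scalarLiouville`).  NS regularity is NOT proved here; 1222 stays OPEN; nothing below is claimed proved unless marked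
# S (routine, paper proof on the card) or K (kernel, this file); T marks a theorem with a complete paper proof on the card,
# C a conjecture, F a literature fact used as a hypothesis.

## The stratum
The would-be counterexamples to W1 that are STEADY and FED FROM INFINITY WITH FINITE DISSIPATION: Leray's `D`-solutions
(`∇u ∈ L²(ℝ³)`, `u → 0`) whose vortex lines lie on the spheres about `x₀` (`⟪curl u, x − x₀⟫ ≡ 0`).  Their non-existence
`SteadyPoloidalDLiouville` (T0) is the poloidal sector of Galdi's open Liouville problem and a NECESSARY sub-statement of
the wall (`StubScalarLiouville` ⊇ steady decaying flows, via g5's class bridge F2/G1); known before this card only in the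
axisymmetric-without-swirl sector (Korobkov–Pileckas–Russo 2015) and under isotropic integrability (`u ∈ L^{9/2}`, Galdi;
`BMO⁻¹`, Seregin 2016; one-component `u_ρ ∈ L^p`, `3/2 < p ≤ 3`, and `u_ρ ∈ L^{3+η(·)}` with `u_ρ` the SPHERICAL radial
component about a centre — axis-free — Vergara-Hermosilla 2026 Thm 1.1/1.2; v1.1 CORRECTION (critic V25-P1): v1.0 wrongly called
that criterion axis-based; the delta of T1/T2 below is exponent-free RATIO / tameness vs. integrability, and the virial flux vs. the
localised energy identity).

v1.1 (2026-08-29, after verdict V25 PASS-WITH-PRICE of ns-wall-crit-1): DOCSTRINGS ONLY — every statement is v1.0 verbatim (BC7: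
ideator 8/8 CLEAN, critic 12/12 CLEAN).  LEAN SIZES BY NAME (critic V25-P2, adopted): V1/V1′ S/M; B `FluxProfile` M given F1, F2
(sphere-free route r1 in its docstring); F2 `HeadNonpositive` M (weak maximum principle on balls — not in Mathlib); H `HodgeSlavingShell`
L (Hodge on S², sharp λ₁(S²) = 2, shell disintegration — none in Mathlib); F1 `DSolutionPressureLimit` literature-grade (Galdi X.5.1,
XL; a named fact iff booked) — so T1 by name ≈ M–L modulo F1, T2 ≈ L+ modulo F1; BOOKING (V25-P3): W1 movement 0, T0 no rung credit,
T1/T2 = stratum theorems (information-grade portrait); if T2 lands: «`PoloidalTameLiouville` LANDED BY NAME (modulo F1 as booked) —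
conditional Liouville on the steady finite-dissipation poloidal stratum; W1 movement 0; `--supports 1222 --as helper`».

## The lever (new): KPR's test-field identity transplanted from CYLINDERS about an axis to SPHERES about the centre
For steady NS, `div[p g + ⟪u,g⟫u] = p div g + ⟪(u·∇)g, u⟫ + ⟪g, Δu⟫`.  With `g = φ(r)(x − x₀)` the viscous term is an exact,
flux-free divergence `⟪g, Δu⟫ = −div(φ · curl u × (x − x₀))` for EVERY flow, so (writing `m = ⟪x − x₀, u⟫ = r u_r`):
  (V1)  `div[p y + m u + ω × y] = 3p + |u|²`,            (V1′) `div[r⁻³(p y + m u + ω × y)] = r⁻⁵(r²|u|² − 3m²)`  (`y = x − x₀`),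
i.e. for the spherical means `P, E_r, E_t` of `p, u_r², |u_tan|²`:  `r (P + E_r)′ = E_t − 2E_r`  — viscosity-free, and
(V0) TIME-INDEPENDENT: `∫_{B_t} φ(r)⟪y, ∂ₜu⟫ = 0` for every divergence-free `∂ₜu`, so (V1), (V1′) hold slice-wise for
UNSTEADY flows (W1's class), invariant under the pressure gauge `p ↦ p + c(t) + ⟪d(t), y⟫`.
For `D`-solutions the head `Φ = p − p_∞ + |u|²/2` is `≤ 0` (maximum principle for `ΔΦ − u·∇Φ = |ω|²`), whence
  (T1) RADIAL-DOMINANCE LIOUVILLE (all `D`-solutions, any centre): if on every far shell the `r⁻³`-weighted tangential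
       energy is at most twice the radial one, `u ≡ 0`.  Contrapositive PORTRAIT: a non-trivial `D`-solution is tangentially
       dominated at infinity about every centre.
Poloidal input (H, HODGE SLAVING): `⟪curl u, y⟫ = 0` says `u_tan` is CURL-FREE on every sphere, so `u_tan = ∇_S ψ` with
`Δ_S ψ = −r⁻² ∂_r(r² u_r)` (incompressibility): the tangential velocity is slaved to the radial one sphere by sphere, and
`λ₁(S_r) = 2/r²` gives `∮_{S_r} r²|u_tan|² ≤ ½ ∮_{S_r} (∂_r(r²u_r))²`.  Hence
  (T2) POLOIDAL TAMENESS LIOUVILLE: a steady poloidal `D`-solution whose radial flux is log-radially tame outside a ball,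
       `|∂_r(r² u_r)| ≤ 2 r |u_r|` (e.g. `u_r = c(ξ) r^{−k}`, `0 ≤ k ≤ 4`, ANY angular pattern `c`), is trivial — the first
       axis-free (conditional) Liouville criterion on this stratum, as far as searched.
NEGATION RECORD (where a steady decaying counterexample can still live): far field tangentially dominated about `x₀`
(T1), radial flux `r²u_r` NOT tame — sign changes or log-slope outside `[−2, 2]` along rays on every far sphere (T2) —,
spherical-mean decay no faster than `r^{−2/3}`-scale integrability allows (`u ∉ L^{9/2}`), cylindrical `u_ρ ∉ L^p` (`p ≤ 3`) about every axis.
KERNEL (v1.0): the PDE input of T1 is packaged as ONE classical fact B `FluxProfile` (ball inequality + shell identity +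
decay of the sphere-flux profile `G`) and the rest is checked here: `radialDominanceLiouville_of : B → T1` (K5),
`poloidalTameLiouville_of : T1 → H → T2` (K4), `poloidalTameLiouville_of_profile : B → H → T2` (K6),
`steadyPoloidalDLiouville_of_galdi : GAL → T0` (K0), `wallOnSteadyDecayingStratum_of : T0 → W1ᴰ` (K1); standard axioms only.
-/

set_option linter.dupNamespace false

noncomputable section

namespace Summit.NavierStokesRegularity.NavierStokesRegularity.Cruxes.PoloidalLiouville.CentreVirial

open Set Function MeasureTheory Filter Topology
open Literature.Analysis.FluidPDE (cross curl frobeniusNormSq)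
open Literature.Analysis.FluidPDE.VectorCalculus (divergence IsDivFree)
open Summit.NavierStokesRegularity.NavierStokesRegularity.Theorems.PoloidalLiouville.CentreJet
  (IsUnthreadedAbout IsSteadyNSOn)

/-- ℝ³. -/
abbrev E3 : Type := EuclideanSpace ℝ (Fin 3)

/-! ## Objects -/

/-- Loop momentum `m(x) = ⟪x − x₀, u(x)⟫ = r·u_r` (radial velocity times radius). -/
def mom (x₀ : E3) (u : E3 → E3) (x : E3) : ℝ := inner ℝ (x - x₀) (u x)

/-- Radial flux derivative `∂_r(r² u_r) = m + Dm·(x − x₀)` (derivative of `r·m` along the unit radial direction). -/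
def radialFluxDeriv (x₀ : E3) (u : E3 → E3) (x : E3) : ℝ :=
  mom x₀ u x + fderiv ℝ (mom x₀ u) x (x - x₀)

/-- The centre-virial flux field `F = p·y + m·u + curl u × y`, `y = x − x₀`. -/
def virialField (x₀ : E3) (u : E3 → E3) (p : E3 → ℝ) (x : E3) : E3 :=
  p x • (x - x₀) + mom x₀ u x • u x + cross (curl u x) (x - x₀)

/-- The open spherical shell `a < |x − x₀| < b`. -/
def shell (x₀ : E3) (a b : ℝ) : Set E3 := {x | a < ‖x - x₀‖ ∧ ‖x - x₀‖ < b}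

/-- `r⁻³`-weighted tangential kinetic energy density `r⁻⁵(r²|u|² − m²) = r⁻³ |u_tan|²`. -/
def tanDensity (x₀ : E3) (u : E3 → E3) (x : E3) : ℝ :=
  (‖x - x₀‖ ^ 2 * ‖u x‖ ^ 2 - mom x₀ u x ^ 2) / ‖x - x₀‖ ^ 5

/-- `r⁻³`-weighted radial kinetic energy density `r⁻⁵ m² = r⁻³ u_r²`. -/
def radDensity (x₀ : E3) (u : E3 → E3) (x : E3) : ℝ :=
  mom x₀ u x ^ 2 / ‖x - x₀‖ ^ 5

/-- Leray–Galdi `D`-solution on `ℝ³`: classical steady Navier–Stokes (`ν = 1`, no force), finite Dirichlet integral,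
uniform decay `u → 0` at infinity.  (The class of Galdi's Liouville CONJECTURE; regular by Galdi 2011 Thm X.1.1.)
TYPING NOTE (v1.1, critic V25-P4): the decay `Tendsto u (cocompact E3) (𝓝 0)` is carried as a FIELD; for `Ḣ¹` steady solutions
it is a THEOREM (Galdi 2011 X.5.1 / elliptic regularity), so this class is nominally NARROWER than Galdi's / Vergara-Hermosilla's `Ḣ¹`
class — harmless for Liouville statements (it only weakens them nominally); a later version may replace the field by a cited fact. -/
def IsDSolution (u : E3 → E3) (p : E3 → ℝ) : Prop :=
  IsSteadyNSOn univ u p ∧ Integrable (fun x => frobeniusNormSq (fderiv ℝ u x)) ∧ Tendsto u (cocompact E3) (𝓝 0)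

/-! ## V — the centre-virial identities (S: product rule + `div(ω × y) = ⟪y, curl ω⟫ = −⟪y, Δu⟫`) -/

/-- (V0, S) **Radial moments of divergence-free fields vanish on balls**: `∫_{B_t(x₀)} φ(|y|)⟪y, w⟫ = 0`
(`φ(r) y = ∇Ψ(r)`, `Ψ′ = rφ`; `∫ ⟪∇Ψ, w⟫ = Ψ(t)·∮_{S_t} w·ŷ = Ψ(t) ∫_{B_t} div w = 0`).  Applied to `w = ∂ₜu` it removes the
time derivative from the integrated virial identities: they hold slice-wise for UNSTEADY incompressible flows. -/
def RadialMomentVanishes : Prop :=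
  ∀ (x₀ : E3) (w : E3 → E3) (φ : ℝ → ℝ) (t : ℝ), ContDiff ℝ 1 w → IsDivFree w → Continuous φ → 0 < t →
    ∫ x in Metric.ball x₀ t, φ ‖x - x₀‖ * inner ℝ (x - x₀) (w x) = 0

/-- (V1, S) **Centre-virial identity**: for a classical steady flow, `div F = 3p + |u|²` with `F = p y + m u + curl u × y`.
Integrated over `B_t(x₀)`: `t ∮_{S_t}(p + u_r²) dσ = ∫_{B_t}(3p + |u|²) dx` (the flux of `curl u × y` through spheres is zero). -/
def CentreVirialIdentity : Prop :=
  ∀ (u : E3 → E3) (p : E3 → ℝ) (x₀ : E3), IsSteadyNSOn univ u p →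
    ∀ x, divergence (virialField x₀ u p) x = 3 * p x + ‖u x‖ ^ 2

/-- (V1′, S) **Weighted centre-virial identity** (test field `y/|y|³`, divergence-free off `x₀`):
`div (r⁻³ F) = r⁻⁵ (r²|u|² − 3m²) = r⁻³(|u_tan|² − 2u_r²)` off `x₀`.  Integrated over a shell:
`G(b) − G(a) = ∫_{a<r<b} r⁻³(|u_tan|² − 2u_r²)`, `G(t) := t⁻² ∮_{S_t}(p + u_r²) dσ`. -/
def WeightedVirialIdentity : Prop :=
  ∀ (u : E3 → E3) (p : E3 → ℝ) (x₀ : E3), IsSteadyNSOn univ u p →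
    ∀ x, x ≠ x₀ → divergence (fun y => (‖y - x₀‖ ^ 3)⁻¹ • virialField x₀ u p y) x =
      (‖x - x₀‖ ^ 2 * ‖u x‖ ^ 2 - 3 * mom x₀ u x ^ 2) / ‖x - x₀‖ ^ 5

/-! ## F — literature inputs on `D`-solutions (facts, used as hypotheses on the card) -/

/-- (F1, F) Pressure of a `D`-solution has a uniform limit at infinity [Galdi 2011, Thm X.5.1; used verbatim in
Chae 2021 JMFM (arXiv:2003.05246) p. 4 and KPR 2015]. -/
def DSolutionPressureLimit : Prop :=
  ∀ (u : E3 → E3) (p : E3 → ℝ), IsDSolution u p → ∃ p₀ : ℝ, Tendsto p (cocompact E3) (𝓝 p₀)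

/-- (F2, S over F1) **Non-positive head**: `Φ = p − p₀ + |u|²/2 ≤ 0` for a `D`-solution (maximum principle for
`ΔΦ − u·∇Φ = |curl u|² ≥ 0` with `Φ → 0`; Chae 2021 (hyp), KPR 2015 Thm 3.6 / book Thm 3.6). -/
def HeadNonpositive : Prop :=
  ∀ (u : E3 → E3) (p : E3 → ℝ) (p₀ : ℝ), IsDSolution u p → Tendsto p (cocompact E3) (𝓝 p₀) →
    ∀ x, p x - p₀ + ‖u x‖ ^ 2 / 2 ≤ 0

/-! ## T1 — radial-dominance Liouville (all `D`-solutions; THEOREM, paper proof on the card §Proofs) -/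

/-- (T1, T) **Radial-dominance Liouville.**  Let `(u, p)` be a `D`-solution and `x₀` a centre.  If on every shell
`t₀ ≤ a < r < b` the `r⁻³`-weighted tangential energy is at most twice the radial one,
`∫ r⁻³|u_tan|² ≤ 2 ∫ r⁻³ u_r²`, then `u ≡ 0`.
Proof (card): F2 + (V1) give `t³G(t) ≤ −½∫_{B_t}|u|²`; (V1′) + hypothesis make `G` non-increasing on `[t₀, ∞)`;
F1 + decay give `G(∞) = 0`; so `0 ≤ G(a) ≤ −(2a³)⁻¹ ∫_{B_a}|u|²` for every `a ≥ t₀`. No unique continuation needed. -/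
def RadialDominanceLiouville : Prop :=
  ∀ (u : E3 → E3) (p : E3 → ℝ) (x₀ : E3) (t₀ : ℝ), IsDSolution u p → 0 < t₀ →
    (∀ a b : ℝ, t₀ ≤ a → a < b →
      ∫ x in shell x₀ a b, tanDensity x₀ u x ≤ 2 * ∫ x in shell x₀ a b, radDensity x₀ u x) →
    ∀ x, u x = 0

/-! ## H — Hodge slaving on spheres (poloidal input; S/M: `H¹_dR(S²) = 0` + `λ₁(S_r) = 2/r²`) -/

/-- (H, S) **Hodge slaving.**  If `u ∈ C¹` is divergence-free and unthreaded about `x₀`, then on every sphere `S_r(x₀)`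
`u_tan = ∇_S ψ`, `Δ_S ψ = −r⁻² ∂_r(r²u_r)`, and `∮ r²|u_tan|² ≤ ½ ∮ (∂_r(r²u_r))²` (equality iff `ψ` is a first harmonic);
integrated against `r⁻⁵ dr` over a shell: -/
def HodgeSlavingShell : Prop :=
  ∀ (u : E3 → E3) (x₀ : E3) (a b : ℝ), ContDiff ℝ 1 u → IsDivFree u → IsUnthreadedAbout x₀ u → 0 < a → a < b →
    ∫ x in shell x₀ a b, tanDensity x₀ u x ≤
      (1 / 2) * ∫ x in shell x₀ a b, radialFluxDeriv x₀ u x ^ 2 / ‖x - x₀‖ ^ 5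

/-! ## T2 — the poloidal theorem; T0 — the residual conjecture of the stratum -/

/-- (T2, T) **Poloidal tameness Liouville.**  A steady poloidal `D`-solution (`⟪curl u, x − x₀⟫ ≡ 0`) whose radial flux is
tame outside a ball, `|∂_r(r² u_r)| ≤ 2 r |u_r|` for `|x − x₀| ≥ t₀`, is trivial.  (From T1 + H: tameness makes
`½(∂_r(r²u_r))² ≤ 2 r² u_r²`; kernel glue `poloidalTameLiouville_of` below.) -/
def PoloidalTameLiouville : Prop :=
  ∀ (u : E3 → E3) (p : E3 → ℝ) (x₀ : E3) (t₀ : ℝ), IsDSolution u p → IsUnthreadedAbout x₀ u → 0 < t₀ →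
    (∀ x, t₀ ≤ ‖x - x₀‖ → |radialFluxDeriv x₀ u x| ≤ 2 * |mom x₀ u x|) →
    ∀ x, u x = 0

/-- (T0, C — OPEN; = Galdi's Liouville problem ∩ the poloidal class; the steady decaying stratum of W1)
**Steady poloidal `D`-Liouville.** -/
def SteadyPoloidalDLiouville : Prop :=
  ∀ (u : E3 → E3) (p : E3 → ℝ) (x₀ : E3), IsDSolution u p → IsUnthreadedAbout x₀ u → ∀ x, u x = 0

/-- (GAL, C — OPEN CONJECTURE of the literature, Galdi 2011 / Seregin 2016; NOT a fact, never used as a hypothesis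
except in the bookkeeping lemma `steadyPoloidalDLiouville_of_galdi`.) -/
def GaldiLiouville : Prop :=
  ∀ (u : E3 → E3) (p : E3 → ℝ), IsDSolution u p → ∀ x, u x = 0

/-- (W1ᴰ) The wall's conclusion on this stratum: the vorticity of a steady poloidal `D`-solution vanishes
(`StubScalarLiouville` restricted to time-independent decaying flows concludes `∇T × y = curl u ≡ 0`). -/
def WallOnSteadyDecayingStratum : Prop :=
  ∀ (u : E3 → E3) (p : E3 → ℝ) (x₀ : E3), IsDSolution u p → IsUnthreadedAbout x₀ u → ∀ x, curl u x = 0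

/-! ## K — kernel bookkeeping -/

/-- (K0) T0 is the poloidal sector of Galdi's conjecture. -/
theorem steadyPoloidalDLiouville_of_galdi (h : GaldiLiouville) : SteadyPoloidalDLiouville :=
  fun u p _ hD _ => h u p hD

/-- The curl of the zero field vanishes. -/
theorem curl_zero (x : E3) : curl (fun _ : E3 => (0 : E3)) x = 0 := by
  unfold Literature.Analysis.FluidPDE.curl
  ext i
  fin_cases i <;> simp

/-- (K1) T0 settles the wall's conclusion on the steady decaying stratum. -/
theorem wallOnSteadyDecayingStratum_of (h : SteadyPoloidalDLiouville) : WallOnSteadyDecayingStratum := by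
  intro u p x₀ hD hU x
  have hu : u = fun _ => (0 : E3) := funext (h u p x₀ hD hU)
  subst hu
  exact curl_zero x

/-- (K2) Tameness squared: `|D| ≤ 2|m| → D² ≤ 4 m²`. -/
theorem sq_le_four_sq_of_tame {D m : ℝ} (h : |D| ≤ 2 * |m|) : D ^ 2 ≤ 4 * m ^ 2 := by
  have h0 : 0 ≤ |D| := abs_nonneg D
  have h1 : |D| ^ 2 ≤ (2 * |m|) ^ 2 := pow_le_pow_left₀ h0 h 2
  have h2 : |D| ^ 2 = D ^ 2 := sq_abs D
  have h3 : |m| ^ 2 = m ^ 2 := sq_abs m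
  nlinarith [h1, h2, h3]

/-- (K3) The single-mode sign behind the negation record: for `u_r = r^{−k} Y_{lm}` the weighted balance
`2E_r − E_t ∝ 2 − (2 − k)²/(l(l+1))` is POSITIVE for every decay rate `0 < k < 4` and degree `l ≥ 1`, so power-law far
fields are radially dominated (hence excluded by T1); tangential domination needs radial OSCILLATION. -/
theorem modeSign (k l : ℝ) (hk : 0 < k) (hk' : k < 4) (hl : 1 ≤ l) : 0 < 2 - (2 - k) ^ 2 / (l * (l + 1)) := by
  have h1 : (2 - k) ^ 2 < 4 := by nlinarith
  have h2 : (2 : ℝ) ≤ l * (l + 1) := by nlinarith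
  have h3 : 0 < l * (l + 1) := by positivity
  have h4 : (2 - k) ^ 2 / (l * (l + 1)) < 2 := by
    rw [div_lt_iff₀ h3]
    nlinarith
  linarith

/-! ## K5 — the real-analysis half of T1, kernel-checked: T1 ⇐ the flux profile (B) -/

/-- (B, S/M) **Flux profile.**  For a `D`-solution and a centre `x₀` there is a profile `G` — namely
`G(t) = t⁻² ∮_{S_t(x₀)} (p − p₀ + u_r²) dσ` with `p₀` the pressure limit (F1) — satisfying
(i) the BALL INEQUALITY `t³ G(t) ≤ −½ ∫_{B_t} |u|²` ((V1) + divergence theorem + head sign F2: `3(p−p₀)+|u|² ≤ −|u|²/2`),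
(ii) the SHELL IDENTITY `G(b) − G(a) = ∫_shell r⁻³|u_tan|² − 2∫_shell r⁻³u_r²` ((V1′) + divergence theorem), and
(iii) DECAY `G(t) → 0` (F1 and `u → 0`).  This packages exactly the PDE input of T1; the rest of T1 is real analysis (K5).
SPHERE-FREE ROUTE r1 (v1.1, critic V25-P2 — the statement below never mentions a surface measure): take the VOLUME form
`G(t) := t⁻³ ∫_{B_t} (3(p − p₀) + |u|²) dx` (= the surface form by (V1)); (i) is F2 pointwise (`3(p−p₀)+|u|² = 3Φ − |u|²/2`);
(iii) is Cesàro from `p → p₀`, `u → 0`; (ii) is WHOLE-SPACE Gauss–Green applied to the compactly supported Lipschitz field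
`(φ_{a,b}(r) − b⁻³) · F`, `φ_{a,b} = (clamp_{[a,b]} r)⁻³`, `F = (p − p₀) y + m u + ω × y` (mollify the two kinks):
`∫_shell div(r⁻³ F) = b⁻³ ∫_{B_b} div F − a⁻³ ∫_{B_a} div F = G(b) − G(a)`, with `div(r⁻³F) = tanDensity − 2·radDensity` by (V1′).
Size: M given F1, F2. -/
def FluxProfile : Prop :=
  ∀ (u : E3 → E3) (p : E3 → ℝ) (x₀ : E3), IsDSolution u p →
    ∃ G : ℝ → ℝ,
      (∀ t : ℝ, 0 < t → t ^ 3 * G t ≤ -(1 / 2) * ∫ x in Metric.ball x₀ t, ‖u x‖ ^ 2) ∧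
      (∀ a b : ℝ, 0 < a → a < b →
          G b - G a = (∫ x in shell x₀ a b, tanDensity x₀ u x) - 2 * ∫ x in shell x₀ a b, radDensity x₀ u x) ∧
      Tendsto G atTop (𝓝 0)

/-- (K5, K) **T1 ⇐ B.**  Radial dominance on the far shells makes `G` non-increasing on `[t₀, ∞)`; with `G → 0` this gives
`G ≥ 0` there; the ball inequality then forces `∫_{B_t}|u|² ≤ 0` for every `t ≥ t₀`, and continuity gives `u ≡ 0`
(every point lies in some such ball — no unique continuation is used). -/
theorem radialDominanceLiouville_of (hB : FluxProfile) : RadialDominanceLiouville := by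
  intro u p x₀ t₀ hD ht₀ hShell x
  obtain ⟨G, hBall, hDiff, hLim⟩ := hB u p x₀ hD
  -- `G` is non-increasing beyond `t₀`
  have hAnti : ∀ a b : ℝ, t₀ ≤ a → a ≤ b → G b ≤ G a := by
    intro a b ha hab
    rcases eq_or_lt_of_le hab with h | h
    · rw [h]
    · have h1 := hDiff a b (lt_of_lt_of_le ht₀ ha) h
      have h2 := hShell a b ha h
      linarith
  -- hence nonnegative beyond `t₀`
  have hGnn : ∀ a : ℝ, t₀ ≤ a → 0 ≤ G a := fun a ha =>
    le_of_tendsto hLim (Filter.eventually_atTop.2 ⟨a, fun b hb => hAnti a b ha hb⟩)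
  by_contra hx
  set t : ℝ := max t₀ (‖x - x₀‖ + 1) with ht_def
  have htpos : 0 < t := lt_of_lt_of_le ht₀ (le_max_left _ _)
  have hxt : x ∈ Metric.ball x₀ t := by
    rw [Metric.mem_ball, dist_eq_norm]
    exact lt_of_lt_of_le (lt_add_one _) (le_max_right _ _)
  have hle : ∫ z in Metric.ball x₀ t, ‖u z‖ ^ 2 ≤ 0 := by
    have h1 := hBall t htpos
    have h2 : 0 ≤ t ^ 3 * G t := mul_nonneg (pow_nonneg htpos.le 3) (hGnn t (le_max_left _ _))
    linarith
  have hcont : Continuous fun z => ‖u z‖ ^ 2 :=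
    (continuous_norm.comp (contDiffOn_univ.mp hD.1.1).continuous).pow 2
  have hint : IntegrableOn (fun z => ‖u z‖ ^ 2) (Metric.ball x₀ t) volume :=
    (hcont.continuousOn.integrableOn_compact (isCompact_closedBall x₀ t)).mono_set Metric.ball_subset_closedBall
  have hpos : 0 < ∫ z in Metric.ball x₀ t, ‖u z‖ ^ 2 := by
    rw [setIntegral_pos_iff_support_of_nonneg_ae (Eventually.of_forall fun z => sq_nonneg ‖u z‖) hint]
    have hopen : IsOpen (Function.support (fun z => ‖u z‖ ^ 2) ∩ Metric.ball x₀ t) :=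
      (isOpen_ne_fun hcont continuous_const).inter Metric.isOpen_ball
    exact hopen.measure_pos volume ⟨x, pow_ne_zero 2 (norm_ne_zero_iff.2 hx), hxt⟩
  linarith

/-! ## K4 — the reduction T2 ⇐ T1 + H, kernel-checked -/

/-- The shell is `ball b ∖ closedBall a`. -/
theorem shell_eq (x₀ : E3) (a b : ℝ) : shell x₀ a b = Metric.ball x₀ b \ Metric.closedBall x₀ a := by
  ext x
  simp only [shell, mem_setOf_eq, Set.mem_sdiff, Metric.mem_ball, Metric.mem_closedBall, dist_eq_norm, not_le]
  tauto

theorem measurableSet_shell (x₀ : E3) (a b : ℝ) : MeasurableSet (shell x₀ a b) := by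
  rw [shell_eq]
  exact Metric.isOpen_ball.measurableSet.diff Metric.isClosed_closedBall.measurableSet

/-- The closed shell `a ≤ r ≤ b` is compact and contains the open shell. -/
theorem shell_subset_closedShell (x₀ : E3) (a b : ℝ) :
    shell x₀ a b ⊆ Metric.closedBall x₀ b \ Metric.ball x₀ a := by
  intro x hx
  simp only [shell, mem_setOf_eq] at hx
  simp only [Set.mem_sdiff, Metric.mem_closedBall, Metric.mem_ball, dist_eq_norm, not_lt]
  exact ⟨hx.2.le, hx.1.le⟩

theorem isCompact_closedShell (x₀ : E3) (a b : ℝ) : IsCompact (Metric.closedBall x₀ b \ Metric.ball x₀ a) :=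
  (isCompact_closedBall x₀ b).diff Metric.isOpen_ball

/-- `m = ⟪· − x₀, u ·⟫` is `C¹` when `u` is. -/
theorem contDiff_mom {u : E3 → E3} (x₀ : E3) (hu : ContDiff ℝ 1 u) : ContDiff ℝ 1 (mom x₀ u) := by
  unfold mom
  exact (contDiff_id.sub contDiff_const).inner ℝ hu

/-- The radial flux derivative is continuous when `u ∈ C¹`. -/
theorem continuous_radialFluxDeriv {u : E3 → E3} (x₀ : E3) (hu : ContDiff ℝ 1 u) :
    Continuous (radialFluxDeriv x₀ u) := by
  have hm := contDiff_mom x₀ hu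
  have h1 : Continuous (mom x₀ u) := hm.continuous
  have h2 : Continuous (fderiv ℝ (mom x₀ u)) := hm.continuous_fderiv one_ne_zero
  have h3 : Continuous fun x : E3 => fderiv ℝ (mom x₀ u) x (x - x₀) :=
    h2.clm_apply (continuous_id.sub continuous_const)
  unfold radialFluxDeriv
  exact h1.add h3

/-- A continuous numerator over `‖x − x₀‖⁵` is integrable on a shell away from the centre. -/
theorem integrableOn_shell_div {f : E3 → ℝ} (x₀ : E3) {a b : ℝ} (ha : 0 < a) (hf : Continuous f) :
    IntegrableOn (fun x => f x / ‖x - x₀‖ ^ 5) (shell x₀ a b) volume := by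
  have hK := isCompact_closedShell x₀ a b
  have hc : ContinuousOn (fun x => f x / ‖x - x₀‖ ^ 5) (Metric.closedBall x₀ b \ Metric.ball x₀ a) := by
    refine hf.continuousOn.div ((continuous_norm.comp (continuous_id.sub continuous_const)).pow 5).continuousOn ?_
    intro x hx
    simp only [Set.mem_sdiff, Metric.mem_ball, dist_eq_norm, not_lt] at hx
    have : 0 < ‖x - x₀‖ := lt_of_lt_of_le ha hx.2
    positivity
  exact (hc.integrableOn_compact hK).mono_set (shell_subset_closedShell x₀ a b)

/-- (K4, K) **T2 ⇐ T1 + H.**  The poloidal tameness Liouville follows from the radial-dominance Liouville and Hodge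
slaving: on every far shell tameness gives `½ (∂_r(r²u_r))² ≤ 2 m²`, hence `∫ r⁻³|u_tan|² ≤ 2 ∫ r⁻³ u_r²`. -/
theorem poloidalTameLiouville_of (hT1 : RadialDominanceLiouville) (hH : HodgeSlavingShell) :
    PoloidalTameLiouville := by
  intro u p x₀ t₀ hD hU ht₀ htame
  refine hT1 u p x₀ t₀ hD ht₀ ?_
  intro a b ha hab
  have ha0 : 0 < a := lt_of_lt_of_le ht₀ ha
  have hC1 : ContDiff ℝ 1 u := (contDiffOn_univ.mp hD.1.1).of_le (by norm_num)
  have hdiv : IsDivFree u := fun x => hD.1.2.2.1 x (mem_univ x)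
  have hS := hH u x₀ a b hC1 hdiv hU ha0 hab
  have hm : Continuous (mom x₀ u) := (contDiff_mom x₀ hC1).continuous
  -- integrability on the shell
  have hI1 : IntegrableOn (fun x => radialFluxDeriv x₀ u x ^ 2 / ‖x - x₀‖ ^ 5) (shell x₀ a b) volume :=
    integrableOn_shell_div x₀ ha0 ((continuous_radialFluxDeriv x₀ hC1).pow 2)
  have hI2 : IntegrableOn (fun x => 4 * radDensity x₀ u x) (shell x₀ a b) volume := by
    have h := integrableOn_shell_div x₀ (f := fun x => 4 * mom x₀ u x ^ 2) (b := b) ha0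
      (continuous_const.mul (hm.pow 2))
    refine h.congr_fun ?_ (measurableSet_shell x₀ a b)
    intro x _
    simp only [radDensity]
    ring
  -- pointwise tameness on the shell
  have hpt : ∀ x ∈ shell x₀ a b, radialFluxDeriv x₀ u x ^ 2 / ‖x - x₀‖ ^ 5 ≤ 4 * radDensity x₀ u x := by
    intro x hx
    simp only [shell, mem_setOf_eq] at hx
    have hr : 0 < ‖x - x₀‖ := lt_trans ha0 hx.1
    have hsq : radialFluxDeriv x₀ u x ^ 2 ≤ 4 * mom x₀ u x ^ 2 :=
      sq_le_four_sq_of_tame (htame x (le_trans ha hx.1.le))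
    have h5 : 0 < ‖x - x₀‖ ^ 5 := by positivity
    simp only [radDensity]
    rw [mul_div_assoc']
    exact div_le_div_of_nonneg_right hsq h5.le
  have hmono : ∫ x in shell x₀ a b, radialFluxDeriv x₀ u x ^ 2 / ‖x - x₀‖ ^ 5 ≤
      ∫ x in shell x₀ a b, 4 * radDensity x₀ u x :=
    setIntegral_mono_on hI1 hI2 (measurableSet_shell x₀ a b) hpt
  have h4 : ∫ x in shell x₀ a b, 4 * radDensity x₀ u x = 4 * ∫ x in shell x₀ a b, radDensity x₀ u x :=
    integral_const_mul 4 _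
  calc ∫ x in shell x₀ a b, tanDensity x₀ u x
      ≤ (1 / 2) * ∫ x in shell x₀ a b, radialFluxDeriv x₀ u x ^ 2 / ‖x - x₀‖ ^ 5 := hS
    _ ≤ (1 / 2) * ∫ x in shell x₀ a b, 4 * radDensity x₀ u x :=
        mul_le_mul_of_nonneg_left hmono (by norm_num)
    _ = 2 * ∫ x in shell x₀ a b, radDensity x₀ u x := by rw [h4]; ring

/-- (K6, K) **T2 ⇐ B + H** — the whole poloidal tameness Liouville theorem reduced, in kernel, to the two classical
PDE/geometry facts: the flux profile (B: identities V1/V1′ + facts F1/F2) and Hodge slaving on spheres (H). -/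
theorem poloidalTameLiouville_of_profile (hB : FluxProfile) (hH : HodgeSlavingShell) : PoloidalTameLiouville :=
  poloidalTameLiouville_of (radialDominanceLiouville_of hB) hH

/-- (K7, K) On the steady decaying stratum the WALL's conclusion follows from T0; and T0 ⇐ Galdi.  Recorded chain:
`GaldiLiouville → SteadyPoloidalDLiouville → WallOnSteadyDecayingStratum`. -/
theorem wallOnSteadyDecayingStratum_of_galdi (hG : GaldiLiouville) : WallOnSteadyDecayingStratum :=
  wallOnSteadyDecayingStratum_of (steadyPoloidalDLiouville_of_galdi hG)

end Summit.NavierStokesRegularity.NavierStokesRegularity.Cruxes.PoloidalLiouville.CentreVirial
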